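import Summits.SmoothPoincare4.SmoothPoincare4.Theses.EntropyRung
import Summits.SmoothPoincare4.SmoothPoincare4.Theorems.EntropyRungSubcylindricalExistenceCapFactorRound
import Summits.SmoothPoincare4.SmoothPoincare4.Theorems.EntropyRungSubcylindricalExistenceGradSqFlatChart
import Summits.SmoothPoincare4.SmoothPoincare4.Theorems.EntropyRungSubcylindricalExistenceSetIntegralFlatChart
import Literature.Geometry.Riemannian.PerelmanEntropyCutoff
import Literature.Geometry.Riemannian.BakryEmeryHeatFlow
import Literature.Geometry.Lorentzian.CurvatureSymmetries
import Mathlib.MeasureTheory.Constructions.HaarToSphere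
import Mathlib.MeasureTheory.Measure.Lebesgue.VolumeOfBalls
import Mathlib.Analysis.SpecialFunctions.Integrals.Basic
import HarnessLib

/-!
# The `L²`-norm of the logarithmic cut-off gradients in the flat gauge
# (line `green-blowup-conformal-entropy`, crux `EntropyRung.SubcylindricalExistence`,
# stmt-SmoothPoincare4-10871; helper for Stub D)

For Green data in Schoen's flat gauge at `p` (`φ = extChartAt p` a `g`-isometry on the closed ball
`B̄(y₀, r)`, `G ∘ φ⁻¹ = a/‖y − y₀‖²` there) and a cut-off pair `χ₁² + χ₂² = 1` with `χ₁ = 1` on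
`{G ≤ S}`, `χ₁ = 0` on `{G ≥ S²} ∪ {p}` and `|∇χ₁|² + |∇χ₂|² ≤ (C/log²S) G⁻²|∇G|²` (H6
`logCutoff_exists`, p108083), the conformally invariant quantity `∫ (|∇χ₁|²_g + |∇χ₂|²_g)² dV_g` is
`≤ 16π² (C/log²S)² log S` as soon as the annulus `{S ≤ G ≤ S²}` is captured by the open chart ball:
the integrand vanishes off the annulus (the cut-offs are locally constant there), on the annulus
`G⁻²|∇G|²_g = 4/‖y−y₀‖²` (S0 `stub_gradSqFlatChart` + `CapFactorRound.gradient_green_comp_symm`),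
`dV_g = dy` (S0b `stub_setIntegralFlatChart`), and `∫_{√a/S ≤ ‖z‖ ≤ √(a/S)} ‖z‖⁻⁴ dz = 2π² log √S`
(polar coordinates, `MeasureTheory.integral_fun_norm_addHaar`). Hence the localisation cost tends to
zero like `log^{-3/2} S`. Everything is proved; no definitions, no named facts.
-/

noncomputable section

set_option linter.dupNamespace false

open scoped Manifold ContDiff Topology RealInnerProductSpace
open Set Filter MeasureTheory Metric
open Literature.Geometry.Lorentzian

namespace Summit.SmoothPoincare4.SmoothPoincare4.Theorems

namespace GluingCutoffBound

/-! ### The Euclidean annulus integral -/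

/-- Volume of the unit ball of `ℝ⁴`: `π²/2`. [folklore] -/
theorem volume_real_ball_four :
    (volume : Measure (EuclideanSpace ℝ (Fin 4))).real (ball 0 1) = Real.pi ^ 2 / 2 := by
  have hk : Module.finrank ℝ (EuclideanSpace ℝ (Fin 4)) = 2 * 2 := by simp
  rw [measureReal_def, InnerProductSpace.volume_ball_of_dim_even hk]
  simp only [ENNReal.ofReal_one, one_pow, one_mul, finrank_euclideanSpace_fin]
  rw [ENNReal.toReal_ofReal (by positivity)]
  norm_num [Nat.factorial]

/-- The radial profile `t³ · 1_{[ρ₁,ρ₂]}(t) t⁻⁴ = 1_{[ρ₁,ρ₂]}(t) t⁻¹` is integrable on `(0, ∞)`. [folklore] -/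
theorem integrableOn_radial {ρ₁ ρ₂ : ℝ} (h₁ : 0 < ρ₁) :
    IntegrableOn (fun y : ℝ ↦ y ^ (Module.finrank ℝ (EuclideanSpace ℝ (Fin 4)) - 1) •
      (Icc ρ₁ ρ₂).indicator (fun t : ℝ ↦ (t ^ 4)⁻¹) y) (Ioi 0) := by
  have hpt : ∀ y ∈ Ioi (0 : ℝ), y ^ (Module.finrank ℝ (EuclideanSpace ℝ (Fin 4)) - 1) •
      (Icc ρ₁ ρ₂).indicator (fun t : ℝ ↦ (t ^ 4)⁻¹) y = (Icc ρ₁ ρ₂).indicator (fun t : ℝ ↦ t⁻¹) y := by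
    intro y hy
    simp only [finrank_euclideanSpace_fin, smul_eq_mul]
    by_cases hyI : y ∈ Icc ρ₁ ρ₂
    · rw [indicator_of_mem hyI, indicator_of_mem hyI]
      have hy0 : y ≠ 0 := (mem_Ioi.1 hy).ne'
      field_simp
    · rw [indicator_of_notMem hyI, indicator_of_notMem hyI, mul_zero]
  rw [integrableOn_congr_fun hpt measurableSet_Ioi]
  have hint : IntegrableOn (fun t : ℝ ↦ t⁻¹) (Icc ρ₁ ρ₂) := by
    refine (continuousOn_inv₀.mono ?_).integrableOn_compact isCompact_Icc
    intro t ht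
    exact (h₁.trans_le ht.1).ne'
  have h2 : Integrable ((Icc ρ₁ ρ₂).indicator fun t : ℝ ↦ t⁻¹) :=
    (integrable_indicator_iff measurableSet_Icc).2 hint
  exact h2.integrableOn

/-- `y ↦ 1_{[ρ₁,ρ₂]}(‖y‖) ‖y‖⁻⁴` is integrable on `ℝ⁴`. [folklore] -/
theorem integrable_annulus {ρ₁ ρ₂ : ℝ} (h₁ : 0 < ρ₁) :
    Integrable (fun z : EuclideanSpace ℝ (Fin 4) ↦ (Icc ρ₁ ρ₂).indicator (fun t : ℝ ↦ (t ^ 4)⁻¹) ‖z‖) :=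
  (MeasureTheory.integrable_fun_norm_addHaar volume
    (f := fun t : ℝ ↦ (Icc ρ₁ ρ₂).indicator (fun t : ℝ ↦ (t ^ 4)⁻¹) t)).2 (integrableOn_radial h₁)

/-- **The annulus integral**: `∫_{ℝ⁴} 1_{[ρ₁,ρ₂]}(‖z‖) ‖z‖⁻⁴ dz = 2π² log(ρ₂/ρ₁)` for
`0 < ρ₁ ≤ ρ₂` (polar coordinates: `4 · (π²/2) · ∫_{ρ₁}^{ρ₂} t³ t⁻⁴ dt`). [folklore] -/
theorem integral_annulus_inv_pow_four {ρ₁ ρ₂ : ℝ} (h₁ : 0 < ρ₁) (h₁₂ : ρ₁ ≤ ρ₂) :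
    ∫ z : EuclideanSpace ℝ (Fin 4), (Icc ρ₁ ρ₂).indicator (fun t : ℝ ↦ (t ^ 4)⁻¹) ‖z‖ =
      2 * Real.pi ^ 2 * Real.log (ρ₂ / ρ₁) := by
  have h₂ : 0 < ρ₂ := h₁.trans_le h₁₂
  rw [MeasureTheory.integral_fun_norm_addHaar volume (fun t : ℝ ↦ (Icc ρ₁ ρ₂).indicator (fun t : ℝ ↦ (t ^ 4)⁻¹) t),
    volume_real_ball_four]
  simp only [finrank_euclideanSpace_fin, smul_eq_mul, nsmul_eq_mul, Nat.cast_ofNat]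
  have hrad : ∫ y in Ioi (0 : ℝ), y ^ (4 - 1) * (Icc ρ₁ ρ₂).indicator (fun t : ℝ ↦ (t ^ 4)⁻¹) y =
      Real.log (ρ₂ / ρ₁) := by
    have hpt : ∀ y ∈ Ioi (0 : ℝ), y ^ (4 - 1) * (Icc ρ₁ ρ₂).indicator (fun t : ℝ ↦ (t ^ 4)⁻¹) y =
        (Icc ρ₁ ρ₂).indicator (fun t : ℝ ↦ t⁻¹) y := by
      intro y hy
      by_cases hyI : y ∈ Icc ρ₁ ρ₂
      · rw [indicator_of_mem hyI, indicator_of_mem hyI]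
        have hy0 : y ≠ 0 := (mem_Ioi.1 hy).ne'
        field_simp
      · rw [indicator_of_notMem hyI, indicator_of_notMem hyI, mul_zero]
    rw [setIntegral_congr_fun measurableSet_Ioi hpt, setIntegral_indicator measurableSet_Icc,
      show Ioi (0 : ℝ) ∩ Icc ρ₁ ρ₂ = Icc ρ₁ ρ₂ from
        inter_eq_right.2 fun t ht ↦ mem_Ioi.2 (h₁.trans_le ht.1),
      integral_Icc_eq_integral_Ioc, ← intervalIntegral.integral_of_le h₁₂, integral_inv_of_pos h₁ h₂]
  rw [hrad]
  ring

/-! ### Vanishing of the cut-off gradients off the annulus -/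

section Manifold

variable {M : Type} [TopologicalSpace M] [T2Space M] [SecondCountableTopology M]
  [ChartedSpace (EuclideanSpace ℝ (Fin 4)) M] [IsManifold (𝓡 4) ∞ M] [CompactSpace M]
  [T3Space M] [MeasurableSpace M] [BorelSpace M]
  (g : PseudoRiemannianMetric (𝓡 4) ∞ (EuclideanSpace ℝ (Fin 4)) (TangentSpace (𝓡 4) : M → Type _))

omit [T2Space M] [SecondCountableTopology M] [CompactSpace M] [T3Space M] [MeasurableSpace M]
  [BorelSpace M] in
/-- A function equal to a constant near `x` has `|∇·|²_g (x) = 0`. [folklore] -/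
theorem gradSq_eq_zero_of_eventuallyEq_const {χ : M → ℝ} {x : M} {c : ℝ}
    (h : χ =ᶠ[𝓝 x] fun _ ↦ c) : g.gradSq χ x = 0 := by
  apply g.gradSq_eq_zero_of_mvfderiv_eq_zero
  rw [mvfderiv_congr_of_eventuallyEq h, mvfderiv_const]

omit [T2Space M] [SecondCountableTopology M] [CompactSpace M] [T3Space M] [MeasurableSpace M]
  [BorelSpace M] in
/-- If `χ₁² + χ₂² = 1` and `χ₁` is constant near `x`, both gradient squares vanish at `x`. [folklore] -/
theorem gradSq_pair_eq_zero {χ₁ χ₂ : M → ℝ} (hχ₂ : ContMDiff (𝓡 4) 𝓘(ℝ, ℝ) ∞ χ₂)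
    (h1 : ∀ y, χ₁ y ^ 2 + χ₂ y ^ 2 = 1) {x : M} {c : ℝ} (h : χ₁ =ᶠ[𝓝 x] fun _ ↦ c) :
    g.gradSq χ₁ x + g.gradSq χ₂ x = 0 := by
  have hχ₁0 : g.gradSq χ₁ x = 0 := gradSq_eq_zero_of_eventuallyEq_const g h
  -- `χ₂² = 1 − c²` near `x`
  have h2 : (fun y ↦ χ₂ y ^ 2 + 0) =ᶠ[𝓝 x] fun _ ↦ 1 - c ^ 2 := by
    filter_upwards [h] with y hy
    have := h1 y
    rw [hy] at this
    linarith
  have hχ₂d : MDifferentiableAt (𝓡 4) 𝓘(ℝ, ℝ) χ₂ x := (hχ₂ x).mdifferentiableAt (by simp)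
  have hsq : g.gradSq (fun y ↦ χ₂ y ^ 2 + 0) x = 4 * χ₂ x ^ 2 * g.gradSq χ₂ x :=
    g.gradSq_sq_add_const 0 hχ₂d
  have hsq0 : g.gradSq (fun y ↦ χ₂ y ^ 2 + 0) x = 0 := gradSq_eq_zero_of_eventuallyEq_const g h2
  rw [hsq0] at hsq
  -- either `χ₂ x = 0` (then `χ₂ = 0`? no: use the sign of `1 - c²`) — argue on `χ₂ x`
  rcases eq_or_ne (χ₂ x) 0 with h0 | h0
  · -- `χ₂ x = 0` forces `c² = 1`, so `χ₂² = 0` near `x`, i.e. `χ₂ = 0` near `x`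
    have hc : c ^ 2 = 1 := by
      have := h1 x
      rw [h.self_of_nhds, h0] at this
      linarith
    have hχ₂0 : χ₂ =ᶠ[𝓝 x] fun _ ↦ 0 := by
      filter_upwards [h2] with y hy
      have hy' : χ₂ y ^ 2 = 0 := by rw [hc] at hy; linarith
      exact pow_eq_zero_iff (by norm_num) |>.1 hy'
    rw [hχ₁0, gradSq_eq_zero_of_eventuallyEq_const g hχ₂0, add_zero]
  · have : g.gradSq χ₂ x = 0 := by
      have h4 : 4 * χ₂ x ^ 2 ≠ 0 := by positivity
      exact (mul_eq_zero.1 hsq.symm).resolve_left h4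
    rw [hχ₁0, this, add_zero]

/-! ### The bound -/

/-- **The `L²`-norm of the cut-off gradients in the flat gauge.** See the module docstring:
`∫ (|∇χ₁|²_g + |∇χ₂|²_g)² dV_g ≤ (C/log²S)² · 16π² log S`. -/
theorem cutoff_sq_integral_le [g.HasLeviCivita] (hg : g.IsRiemannian) {p : M} {G : M → ℝ}
    (hGs : ContMDiffOn (𝓡 4) 𝓘(ℝ, ℝ) ∞ G {p}ᶜ) {a r : ℝ} (ha : 0 < a) (hr : 0 < r)
    (hsub : Metric.closedBall (extChartAt (𝓡 4) p p) r ⊆ (extChartAt (𝓡 4) p).target)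
    (hflat : ∀ y ∈ Metric.closedBall (extChartAt (𝓡 4) p p) r, ∀ X W : EuclideanSpace ℝ (Fin 4),
      g.val ((extChartAt (𝓡 4) p).symm y)
        (mfderiv 𝓘(ℝ, EuclideanSpace ℝ (Fin 4)) (𝓡 4) (extChartAt (𝓡 4) p).symm y X)
        (mfderiv 𝓘(ℝ, EuclideanSpace ℝ (Fin 4)) (𝓡 4) (extChartAt (𝓡 4) p).symm y W) = ⟪X, W⟫)
    (hGeq : ∀ y ∈ Metric.closedBall (extChartAt (𝓡 4) p p) r, y ≠ extChartAt (𝓡 4) p p →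
      G ((extChartAt (𝓡 4) p).symm y) = a / ‖y - extChartAt (𝓡 4) p p‖ ^ 2)
    {C S : ℝ} (hC : 0 ≤ C) (hS : 1 < S) (haS : a / r ^ 2 < S)
    {χ₁ χ₂ : M → ℝ} (hχ₁ : ContMDiff (𝓡 4) 𝓘(ℝ, ℝ) ∞ χ₁) (hχ₂ : ContMDiff (𝓡 4) 𝓘(ℝ, ℝ) ∞ χ₂)
    (h1 : ∀ y, χ₁ y ^ 2 + χ₂ y ^ 2 = 1) (hone : ∀ x, x ≠ p → G x ≤ S → χ₁ x = 1)
    (hzero : ∀ x, x ≠ p → S ^ 2 ≤ G x → χ₁ x = 0) (hχ₁p : χ₁ p = 0)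
    (hbound : ∀ x, x ≠ p →
      g.gradSq χ₁ x + g.gradSq χ₂ x ≤ C / Real.log S ^ 2 * ((G x)⁻¹ ^ 2 * g.gradSq G x))
    (hGlim : Tendsto G (𝓝[≠] p) atTop)
    (hcapt : ∀ x, x ≠ p → S ≤ G x →
      x ∈ (extChartAt (𝓡 4) p).source ∧ extChartAt (𝓡 4) p x ∈ Metric.ball (extChartAt (𝓡 4) p p) r) :
    ∫ x, (g.gradSq χ₁ x + g.gradSq χ₂ x) ^ 2 ∂(riemannianMeasure (g.toContMDiffRiemannianMetric hg)) ≤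
      (C / Real.log S ^ 2) ^ 2 * (16 * Real.pi ^ 2 * Real.log S) := by
  set μ : Measure M := riemannianMeasure (g.toContMDiffRiemannianMetric hg) with hμ
  set Q : M → ℝ := fun x ↦ g.gradSq χ₁ x + g.gradSq χ₂ x with hQ
  have hS0 : 0 < S := zero_lt_one.trans hS
  have hlogS : 0 < Real.log S := Real.log_pos hS
  have hGc : ContinuousOn G {p}ᶜ := hGs.continuousOn
  -- (1) vanishing where `G < S`
  have hvan1 : ∀ x, x ≠ p → G x < S → Q x = 0 := by
    intro x hx hGx
    have hev : χ₁ =ᶠ[𝓝 x] fun _ ↦ (1 : ℝ) := by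
      have hopen : IsOpen ({p}ᶜ ∩ G ⁻¹' Iio S) :=
        hGc.isOpen_inter_preimage isOpen_compl_singleton isOpen_Iio
      filter_upwards [hopen.mem_nhds ⟨hx, hGx⟩] with y hy
      exact hone y hy.1 (le_of_lt hy.2)
    exact gradSq_pair_eq_zero g hχ₂ h1 hev
  -- (2) vanishing where `G > S²` and at `p`
  have hvan2 : ∀ x, x ≠ p → S ^ 2 < G x → Q x = 0 := by
    intro x hx hGx
    have hev : χ₁ =ᶠ[𝓝 x] fun _ ↦ (0 : ℝ) := by
      have hopen : IsOpen ({p}ᶜ ∩ G ⁻¹' Ioi (S ^ 2)) :=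
        hGc.isOpen_inter_preimage isOpen_compl_singleton isOpen_Ioi
      filter_upwards [hopen.mem_nhds ⟨hx, hGx⟩] with y hy
      exact hzero y hy.1 (le_of_lt hy.2)
    exact gradSq_pair_eq_zero g hχ₂ h1 hev
  have hvanp : Q p = 0 := by
    have hev : χ₁ =ᶠ[𝓝 p] fun _ ↦ (0 : ℝ) := by
      have hlarge : ∀ᶠ y in 𝓝[≠] p, S ^ 2 ≤ G y := hGlim.eventually (eventually_ge_atTop _)
      rw [eventually_nhdsWithin_iff] at hlarge
      filter_upwards [hlarge] with y hy
      rcases eq_or_ne y p with hyp | hyp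
      · rw [hyp, hχ₁p]
      · exact hzero y hyp (hy hyp)
    exact gradSq_pair_eq_zero g hχ₂ h1 hev
  -- nonnegativity and the pointwise bound off `p`
  have hQ0 : ∀ x, 0 ≤ Q x := fun x ↦ add_nonneg (g.gradSq_nonneg hg χ₁ x) (g.gradSq_nonneg hg χ₂ x)
  -- (3) `Q` vanishes off the closed chart ball
  set Bset : Set M := {x | x ∈ (extChartAt (𝓡 4) p).source ∧ extChartAt (𝓡 4) p x ∈ Metric.closedBall (extChartAt (𝓡 4) p p) r} with hBset
  have hQoff : ∀ x, x ∉ Bset → (Q x) ^ 2 = 0 := by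
    intro x hx
    have hxp : x ≠ p := by
      intro hxp'
      apply hx
      rw [hxp']
      exact ⟨mem_extChartAt_source p, Metric.mem_closedBall_self hr.le⟩
    have hGx : G x < S := by
      by_contra hcon
      obtain ⟨hs, hb⟩ := hcapt x hxp (le_of_not_gt hcon)
      exact hx ⟨hs, Metric.ball_subset_closedBall hb⟩
    rw [hvan1 x hxp hGx]
    ring
  have hQc : Continuous Q :=
    (Literature.Geometry.Riemannian.contMDiff_gradSq g hχ₁).continuous.add
      (Literature.Geometry.Riemannian.contMDiff_gradSq g hχ₂).continuous
  have hstep3 : ∫ x, (Q x) ^ 2 ∂μ = ∫ x in Bset, (Q x) ^ 2 ∂μ :=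
    (setIntegral_eq_integral_of_forall_compl_eq_zero fun x hx ↦ hQoff x hx).symm
  -- (4) read the integral in the chart (S0b)
  have hstep4 : ∫ x in Bset, (Q x) ^ 2 ∂μ = ∫ y in Metric.closedBall (extChartAt (𝓡 4) p p) r, (Q ((extChartAt (𝓡 4) p).symm y)) ^ 2 :=
    stub_setIntegralFlatChart M g hg p r hr hsub hflat (fun x ↦ (Q x) ^ 2) (hQc.pow 2)
  -- (5) pointwise bound in the chart
  set ρ₁ : ℝ := Real.sqrt a / S with hρ₁
  set ρ₂ : ℝ := Real.sqrt (a / S) with hρ₂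
  have hρ₁pos : 0 < ρ₁ := by positivity
  have hρ₁sq : ρ₁ ^ 2 = a / S ^ 2 := by rw [hρ₁, div_pow, Real.sq_sqrt ha.le]
  have hρ₂sq : ρ₂ ^ 2 = a / S := by rw [hρ₂, Real.sq_sqrt (by positivity)]
  have hρ₁₂ : ρ₁ ≤ ρ₂ := by
    have h1' : ρ₁ ^ 2 ≤ ρ₂ ^ 2 := by
      rw [hρ₁sq, hρ₂sq]
      exact div_le_div_of_nonneg_left ha.le hS0 (by nlinarith)
    nlinarith [hρ₁pos, Real.sqrt_nonneg (a / S)]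
  have hρ₂r : ρ₂ < r := by
    have : ρ₂ ^ 2 < r ^ 2 := by
      rw [hρ₂sq, div_lt_iff₀ hS0]
      have := (div_lt_iff₀ (by positivity : (0:ℝ) < r ^ 2)).1 haS
      linarith
    nlinarith [Real.sqrt_nonneg (a / S), hr]
  set κ : ℝ := C / Real.log S ^ 2 * 4 with hκ
  have hκ0 : 0 ≤ κ := by positivity
  set F : EuclideanSpace ℝ (Fin 4) → ℝ := fun y ↦
    κ ^ 2 * (Icc ρ₁ ρ₂).indicator (fun t : ℝ ↦ (t ^ 4)⁻¹) ‖y - (extChartAt (𝓡 4) p p)‖ with hF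
  have hF0 : ∀ y, 0 ≤ F y := fun y ↦ by
    simp only [hF]
    refine mul_nonneg (sq_nonneg _) (indicator_nonneg (fun t _ ↦ by positivity) _)
  have hpt : ∀ y ∈ Metric.closedBall (extChartAt (𝓡 4) p p) r, (Q ((extChartAt (𝓡 4) p).symm y)) ^ 2 ≤ F y := by
    intro y hy
    rcases eq_or_ne y (extChartAt (𝓡 4) p p) with hyy | hyy
    · rw [hyy, extChartAt_to_inv]
      have : Q p = 0 := hvanp
      rw [this]
      simpa using hF0 (extChartAt (𝓡 4) p p)
    have hx : (extChartAt (𝓡 4) p).symm y ≠ p := CapFactorRound.extChartAt_symm_ne_pole (hsub hy) hyy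
    have hd : 0 < ‖y - (extChartAt (𝓡 4) p p)‖ := norm_pos_iff.mpr (sub_ne_zero.mpr hyy)
    have hGy : G ((extChartAt (𝓡 4) p).symm y) = a / ‖y - (extChartAt (𝓡 4) p p)‖ ^ 2 := hGeq y hy hyy
    by_cases hann : ‖y - (extChartAt (𝓡 4) p p)‖ ∈ Icc ρ₁ ρ₂
    · -- on the annulus: `Q ≤ (C/log²S) G⁻²|∇G|² = κ/‖y−(extChartAt (𝓡 4) p p)‖²`
      have hgrad : g.gradSq G ((extChartAt (𝓡 4) p).symm y) = 4 * a ^ 2 / (‖y - (extChartAt (𝓡 4) p p)‖ ^ 2) ^ 3 := by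
        rw [stub_gradSqFlatChart M g p y (hsub hy) (hflat y hy) G
          ((CapFactorRound.contMDiffAt_green hGs hx).mdifferentiableAt (by simp)),
          CapFactorRound.gradient_green_comp_symm hGs hr hsub hGeq hy hyy,
          CapFactorRound.norm_model_gradient_sq a hyy]
      have hQy : Q ((extChartAt (𝓡 4) p).symm y) ≤ κ * (‖y - (extChartAt (𝓡 4) p p)‖ ^ 2)⁻¹ := by
        refine (hbound _ hx).trans_eq ?_
        rw [hgrad, hGy, hκ]
        field_simp
      have hFy : F y = (κ * (‖y - (extChartAt (𝓡 4) p p)‖ ^ 2)⁻¹) ^ 2 := by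
        simp only [hF, indicator_of_mem hann]
        field_simp
      rw [hFy]
      exact pow_le_pow_left₀ (hQ0 _) hQy 2
    · -- off the annulus: `Q = 0`
      have hQy : Q ((extChartAt (𝓡 4) p).symm y) = 0 := by
        rw [mem_Icc, not_and_or, not_le, not_le] at hann
        rcases hann with hlt | hgt
        · -- `‖y−(extChartAt (𝓡 4) p p)‖ < ρ₁`: `G > S²`
          refine hvan2 _ hx ?_
          rw [hGy, lt_div_iff₀ (by positivity)]
          have : ‖y - (extChartAt (𝓡 4) p p)‖ ^ 2 < ρ₁ ^ 2 := pow_lt_pow_left₀ hlt (norm_nonneg _) two_ne_zero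
          rw [hρ₁sq, lt_div_iff₀ (by positivity)] at this
          linarith
        · -- `‖y−(extChartAt (𝓡 4) p p)‖ > ρ₂`: `G < S`
          refine hvan1 _ hx ?_
          rw [hGy, div_lt_iff₀ (by positivity)]
          have : ρ₂ ^ 2 < ‖y - (extChartAt (𝓡 4) p p)‖ ^ 2 := pow_lt_pow_left₀ hgt (Real.sqrt_nonneg _) two_ne_zero
          rw [hρ₂sq, div_lt_iff₀ hS0] at this
          linarith
      rw [hQy]
      simpa using hF0 y
  -- (6) integrate
  have hFint : Integrable F := by
    have h := (integrable_annulus (ρ₂ := ρ₂) hρ₁pos).comp_sub_right (extChartAt (𝓡 4) p p)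
    exact h.const_mul (κ ^ 2)
  have hstep6 : ∫ y in Metric.closedBall (extChartAt (𝓡 4) p p) r, (Q ((extChartAt (𝓡 4) p).symm y)) ^ 2 ≤ ∫ y, F y := by
    calc ∫ y in Metric.closedBall (extChartAt (𝓡 4) p p) r, (Q ((extChartAt (𝓡 4) p).symm y)) ^ 2
        ≤ ∫ y in Metric.closedBall (extChartAt (𝓡 4) p p) r, F y := by
          refine setIntegral_mono_on ?_ hFint.integrableOn measurableSet_closedBall hpt
          -- integrability of the left side: it is the chart image of an integrable function; use
          -- domination by `F`
          refine Integrable.mono' hFint.integrableOn ?_ ?_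
          · have hcont : ContinuousOn (fun y ↦ (Q ((extChartAt (𝓡 4) p).symm y)) ^ 2) (Metric.closedBall (extChartAt (𝓡 4) p p) r) :=
              ((hQc.pow 2).comp_continuousOn ((continuousOn_extChartAt_symm p).mono hsub))
            exact hcont.aestronglyMeasurable measurableSet_closedBall
          · refine (ae_restrict_iff' measurableSet_closedBall).2 (ae_of_all _ fun y hy ↦ ?_)
            rw [Real.norm_eq_abs, abs_of_nonneg (sq_nonneg _)]
            exact hpt y hy
      _ ≤ ∫ y, F y := setIntegral_le_integral hFint (ae_of_all _ hF0)
  have hstep7 : ∫ y, F y = κ ^ 2 * (2 * Real.pi ^ 2 * Real.log (ρ₂ / ρ₁)) := by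
    simp only [hF]
    rw [integral_const_mul]
    congr 1
    have := MeasureTheory.integral_sub_right_eq_self (μ := (volume : Measure (EuclideanSpace ℝ (Fin 4))))
      (fun z : EuclideanSpace ℝ (Fin 4) ↦ (Icc ρ₁ ρ₂).indicator (fun t : ℝ ↦ (t ^ 4)⁻¹) ‖z‖) (extChartAt (𝓡 4) p p)
    rw [this, integral_annulus_inv_pow_four hρ₁pos hρ₁₂]
  have hlog : Real.log (ρ₂ / ρ₁) = Real.log S / 2 := by
    have hratio : ρ₂ / ρ₁ = Real.sqrt S := by
      rw [hρ₂, hρ₁, Real.sqrt_div ha.le, div_div_eq_mul_div]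
      have hsS : Real.sqrt S ≠ 0 := (Real.sqrt_pos.2 hS0).ne'
      have hsa : Real.sqrt a ≠ 0 := (Real.sqrt_pos.2 ha).ne'
      field_simp
      exact (Real.sq_sqrt hS0.le).symm
    rw [hratio, Real.log_sqrt hS0.le]
  calc ∫ x, (Q x) ^ 2 ∂μ = ∫ y in Metric.closedBall (extChartAt (𝓡 4) p p) r, (Q ((extChartAt (𝓡 4) p).symm y)) ^ 2 := by rw [hstep3, hstep4]
    _ ≤ ∫ y, F y := hstep6
    _ = κ ^ 2 * (2 * Real.pi ^ 2 * Real.log (ρ₂ / ρ₁)) := hstep7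
    _ = (C / Real.log S ^ 2) ^ 2 * (16 * Real.pi ^ 2 * Real.log S) := by rw [hlog, hκ]; ring

end Manifold

end GluingCutoffBound

/-- **The `L²`-norm of the logarithmic cut-off gradients in the flat gauge** (registered sub-goal
`gluingCutoffSqIntegral` of Stub D of line `green-blowup-conformal-entropy`; ∀-form of
`GluingCutoffBound.cutoff_sq_integral_le`): `∫ (|∇χ₁|²_g + |∇χ₂|²_g)² dV_g ≤ (C/log²S)² · 16π² log S`.
[folklore] -/
theorem gluingCutoffSqIntegral :
    ∀ (M : Type) [TopologicalSpace M] [T2Space M] [SecondCountableTopology M]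
      [ChartedSpace (EuclideanSpace ℝ (Fin 4)) M] [IsManifold (𝓡 4) ∞ M] [CompactSpace M]
      [T3Space M] [MeasurableSpace M] [BorelSpace M]
      (g : PseudoRiemannianMetric (𝓡 4) ∞ (EuclideanSpace ℝ (Fin 4)) (TangentSpace (𝓡 4) : M → Type _))
      [g.HasLeviCivita] (hg : g.IsRiemannian) (p : M) (G : M → ℝ),
      ContMDiffOn (𝓡 4) 𝓘(ℝ, ℝ) ∞ G {p}ᶜ → ∀ (a r : ℝ), 0 < a → 0 < r →
      Metric.closedBall (extChartAt (𝓡 4) p p) r ⊆ (extChartAt (𝓡 4) p).target →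
      (∀ y ∈ Metric.closedBall (extChartAt (𝓡 4) p p) r, ∀ X W : EuclideanSpace ℝ (Fin 4),
        g.val ((extChartAt (𝓡 4) p).symm y)
          (mfderiv 𝓘(ℝ, EuclideanSpace ℝ (Fin 4)) (𝓡 4) (extChartAt (𝓡 4) p).symm y X)
          (mfderiv 𝓘(ℝ, EuclideanSpace ℝ (Fin 4)) (𝓡 4) (extChartAt (𝓡 4) p).symm y W) = ⟪X, W⟫) →
      (∀ y ∈ Metric.closedBall (extChartAt (𝓡 4) p p) r, y ≠ extChartAt (𝓡 4) p p →
        G ((extChartAt (𝓡 4) p).symm y) = a / ‖y - extChartAt (𝓡 4) p p‖ ^ 2) →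
      ∀ (C S : ℝ), 0 ≤ C → 1 < S → a / r ^ 2 < S →
      ∀ (χ₁ χ₂ : M → ℝ), ContMDiff (𝓡 4) 𝓘(ℝ, ℝ) ∞ χ₁ → ContMDiff (𝓡 4) 𝓘(ℝ, ℝ) ∞ χ₂ →
      (∀ y, χ₁ y ^ 2 + χ₂ y ^ 2 = 1) → (∀ x, x ≠ p → G x ≤ S → χ₁ x = 1) →
      (∀ x, x ≠ p → S ^ 2 ≤ G x → χ₁ x = 0) → χ₁ p = 0 →
      (∀ x, x ≠ p → g.gradSq χ₁ x + g.gradSq χ₂ x ≤ C / Real.log S ^ 2 * ((G x)⁻¹ ^ 2 * g.gradSq G x)) →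
      Tendsto G (𝓝[≠] p) atTop →
      (∀ x, x ≠ p → S ≤ G x →
        x ∈ (extChartAt (𝓡 4) p).source ∧ extChartAt (𝓡 4) p x ∈ Metric.ball (extChartAt (𝓡 4) p p) r) →
      ∫ x, (g.gradSq χ₁ x + g.gradSq χ₂ x) ^ 2 ∂(riemannianMeasure (g.toContMDiffRiemannianMetric hg)) ≤
        (C / Real.log S ^ 2) ^ 2 * (16 * Real.pi ^ 2 * Real.log S) := by
  intro M _ _ _ _ _ _ _ _ _ g _ hg p G hGs a r ha hr hsub hflat hGeq C S hC hS haS χ₁ χ₂ hχ₁ hχ₂ h1 hone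
    hzero hχ₁p hbound hGlim hcapt
  exact GluingCutoffBound.cutoff_sq_integral_le g hg hGs ha hr hsub hflat hGeq hC hS haS hχ₁ hχ₂ h1 hone
    hzero hχ₁p hbound hGlim hcapt

end Summit.SmoothPoincare4.SmoothPoincare4.Theorems

end
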